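/-
Origin: expansion seat `planner-pub-hodgecm-toy-g2-0`, handover #21 2026-08-18T08:36:40Z (`HOME/pub-hodgecm-toy-g2/lean/ToyG2/TrTypeProd.lean`, md5 24237384, 270 lines);
landed by the gen-7 packager in gate run 27 as `HodgeCM/Model/ToyG2/TrTypeProd.lean` (import ^import ToyG2\.→import HodgeCM.Model.ToyG2. ×1).
-/
/-
# HodgeCM.Model.ToyG2.TrTypeProd — the product rule for `TrType` (complexified Künneth)

Generation 2 of the `pub-hodgecm-toy` lineage (seat `planner-pub-hodgecm-toy-g2-0`), DESIGN.md §9 (G2b′).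

**`trType_prod`** : `TrType X → TrType Y → TrType (X × Y)` — if the traces of `X` and `Y` have Hodge
types `(dim X, dim X)` and `(dim Y, dim Y)`, the Künneth trace `tr_{X×Y} = tr_X ⊠ tr_Y` has type
`(dim X + dim Y, dim X + dim Y)`.  With `TopWeight.trType_of_isBlockFree` (atoms, block-free objects) and
`GysinPlan.trType_pbObj` (good blocks) this gives `TrType` for EVERY good object (`trType_of_good`), i.e.
the hypothesis `hT` of `GysinPlan.gysin_of` outright: `gysin_of_rad_riesz`, `toyUniverse₃_modelAxioms_of'`
(28/28 from `RadKilled` + `HodgeRiesz` alone).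

Method (no eigenvector expansions): (1) the complexification of the exterior product of forms is the
exterior product of the complexifications (`baseCA_trOf_prod`, checked on families of vectors `1 ⊗ b_i`
of a rational basis via `Basis.ext_alternating`, where both sides are the same explicit shuffle sum);
(2) `compLinearMap` by an operator respecting the product decomposition distributes over the exterior
product (`prodFormC_compLinearMap`), and the weight operator `wtL z` of `X × Y` does respect it because the
coordinate restrictions are Hodge maps (`HodgeWeight.IsHodge.wtL_comp`); (3) bilinearity.
-/
import Mathlib
import Summits.HodgeConjecture.HodgeCM.Model.ToyG2.TopWeight

namespace HodgeCM.ToyG2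

open HodgeCM.Toy HodgeCM.Toy.CMPresentation
open Literature.AlgebraicGeometry.Motives
open scoped TensorProduct
open exteriorPower Obj₂

noncomputable section

/-! ### §1 Generic evaluation of `domCoprod` -/

section DomCoprod

variable {R : Type*} [CommRing R] {M M₂ N₁ N₂ : Type*} [AddCommGroup M] [Module R M]
  [AddCommGroup M₂] [Module R M₂] [AddCommGroup N₁] [Module R N₁] [AddCommGroup N₂] [Module R N₂]
  {ιa ιb : Type*} [Fintype ιa] [Fintype ιb] [DecidableEq ιa] [DecidableEq ιb]

/-- `domCoprod` evaluated: the shuffle sum -/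
theorem domCoprod_apply_eq_sum (a : M [⋀^ιa]→ₗ[R] N₁) (b : M [⋀^ιb]→ₗ[R] N₂) (v : ιa ⊕ ιb → M) :
    a.domCoprod b v
      = ∑ σ : Equiv.Perm.ModSumCongr ιa ιb, AlternatingMap.domCoprod.summand a b σ v := by
  change (⇑(∑ σ : Equiv.Perm.ModSumCongr ιa ιb, AlternatingMap.domCoprod.summand a b σ)) v = _
  rw [_root_.sum_apply]

/-- one shuffle term, evaluated -/
theorem domCoprod_summand_mk_apply (a : M [⋀^ιa]→ₗ[R] N₁) (b : M [⋀^ιb]→ₗ[R] N₂)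
    (σ : Equiv.Perm (ιa ⊕ ιb)) (v : ιa ⊕ ιb → M) :
    AlternatingMap.domCoprod.summand a b (Quotient.mk'' σ) v
      = Equiv.Perm.sign σ •
          (a (fun i => v (σ (Sum.inl i))) ⊗ₜ[R] b (fun j => v (σ (Sum.inr j)))) := by
  rw [AlternatingMap.domCoprod.summand_mk'', _root_.smul_apply, MultilinearMap.domDomCongr_apply,
    MultilinearMap.domCoprod_apply]
  rfl

/-- `compLinearMap` distributes over `domCoprod` -/
theorem domCoprod_compLinearMap (a : M [⋀^ιa]→ₗ[R] N₁) (b : M [⋀^ιb]→ₗ[R] N₂) (f : M₂ →ₗ[R] M) :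
    (a.domCoprod b).compLinearMap f = (a.compLinearMap f).domCoprod (b.compLinearMap f) := by
  refine AlternatingMap.ext fun v => ?_
  rw [AlternatingMap.compLinearMap_apply, domCoprod_apply_eq_sum, domCoprod_apply_eq_sum]
  refine Finset.sum_congr rfl fun σ _ => Quotient.inductionOn' σ fun σ => ?_
  rw [domCoprod_summand_mk_apply, domCoprod_summand_mk_apply]
  rfl

end DomCoprod

/-! ### §2 Base change of a shuffle sum of pulled-back forms -/

/-- If `α₂`, `β₂` extend `α₁`, `β₁` to the complexification (on rational families), then the complex
exterior product of the pulled-back forms extends the rational one. -/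
theorem lid_domCoprod_baseChange {ιa ιb : Type*} [Fintype ιa] [Fintype ιb] [DecidableEq ιa]
    [DecidableEq ιb] {V W₁ W₂ : Type*} [AddCommGroup V] [Module ℚ V] [AddCommGroup W₁] [Module ℚ W₁]
    [AddCommGroup W₂] [Module ℚ W₂] (P₁ : V →ₗ[ℚ] W₁) (P₂ : V →ₗ[ℚ] W₂)
    (α₁ : W₁ [⋀^ιa]→ₗ[ℚ] ℚ) (β₁ : W₂ [⋀^ιb]→ₗ[ℚ] ℚ)
    (α₂ : (ℂ ⊗[ℚ] W₁) [⋀^ιa]→ₗ[ℂ] ℂ) (β₂ : (ℂ ⊗[ℚ] W₂) [⋀^ιb]→ₗ[ℂ] ℂ)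
    (hα : ∀ x : ιa → W₁, α₂ (fun i => (1 : ℂ) ⊗ₜ[ℚ] x i) = (α₁ x : ℂ))
    (hβ : ∀ y : ιb → W₂, β₂ (fun j => (1 : ℂ) ⊗ₜ[ℚ] y j) = (β₁ y : ℂ)) (w : ιa ⊕ ιb → V) :
    TensorProduct.lid ℂ ℂ (((α₂.compLinearMap (P₁.baseChange ℂ)).domCoprod
        (β₂.compLinearMap (P₂.baseChange ℂ))) (fun i => (1 : ℂ) ⊗ₜ[ℚ] w i))
      = ((TensorProduct.lid ℚ ℚ (((α₁.compLinearMap P₁).domCoprod (β₁.compLinearMap P₂)) w) : ℚ) : ℂ) := by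
  rw [domCoprod_apply_eq_sum, domCoprod_apply_eq_sum, map_sum, map_sum, Rat.cast_sum]
  refine Finset.sum_congr rfl fun σ _ => Quotient.inductionOn' σ fun σ => ?_
  rw [domCoprod_summand_mk_apply, domCoprod_summand_mk_apply, Units.smul_def, Units.smul_def,
    map_zsmul, map_zsmul, TensorProduct.lid_tmul, TensorProduct.lid_tmul, smul_eq_mul, smul_eq_mul]
  simp only [AlternatingMap.compLinearMap_apply, LinearMap.baseChange_tmul]
  rw [hα (fun i => P₁ (w (σ (Sum.inl i)))), hβ (fun j => P₂ (w (σ (Sum.inr j)))),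
    zsmul_eq_mul, zsmul_eq_mul]
  push_cast
  ring

/-! ### §3 The complex exterior product of forms on `H¹(A × B, ℂ)` -/

section ProdC

variable {A B : Obj}

/-- `ℂ`-linear restriction to the `A`-coordinates -/
abbrev fstC (A B : Obj) : (A.prod B).LC →ₗ[ℂ] A.LC := (fstL A B).baseChange ℂ

/-- `ℂ`-linear restriction to the `B`-coordinates -/
abbrev sndC (A B : Obj) : (A.prod B).LC →ₗ[ℂ] B.LC := (sndL A B).baseChange ℂ

/-- exterior product of complex forms: the complex analogue of `Trace.prodForm` -/
def prodFormC {m n : ℕ} (α : A.LC [⋀^Fin m]→ₗ[ℂ] ℂ) (β : B.LC [⋀^Fin n]→ₗ[ℂ] ℂ) :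
    (A.prod B).LC [⋀^Fin (m + n)]→ₗ[ℂ] ℂ :=
  ((TensorProduct.lid ℂ ℂ).toLinearMap.compAlternatingMap
    ((α.compLinearMap (fstC A B)).domCoprod (β.compLinearMap (sndC A B)))).domDomCongr finSumFinEquiv

/-- (Ported verbatim from the HodgeCMPerL package; no docstring in the source.) -/
lemma prodFormC_apply {m n : ℕ} (α : A.LC [⋀^Fin m]→ₗ[ℂ] ℂ) (β : B.LC [⋀^Fin n]→ₗ[ℂ] ℂ)
    (v : Fin (m + n) → (A.prod B).LC) :
    prodFormC α β v = TensorProduct.lid ℂ ℂ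
      (((α.compLinearMap (fstC A B)).domCoprod (β.compLinearMap (sndC A B))) (v ∘ finSumFinEquiv)) := by
  rw [prodFormC, AlternatingMap.domDomCongr_apply, LinearMap.compAlternatingMap_apply]
  rfl

/-- (Ported verbatim from the HodgeCMPerL package; no docstring in the source.) -/
lemma prodForm_apply' {m n : ℕ} (α : A.L [⋀^Fin m]→ₗ[ℚ] ℚ) (β : B.L [⋀^Fin n]→ₗ[ℚ] ℚ)
    (v : Fin (m + n) → (A.prod B).L) :
    prodForm α β v = TensorProduct.lid ℚ ℚ
      (((α.compLinearMap (fstL A B)).domCoprod (β.compLinearMap (sndL A B))) (v ∘ finSumFinEquiv)) := by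
  rw [prodForm, AlternatingMap.domDomCongr_apply, LinearMap.compAlternatingMap_apply]
  rfl

/-- bilinearity -/
lemma prodFormC_smul {m n : ℕ} (c d : ℂ) (α : A.LC [⋀^Fin m]→ₗ[ℂ] ℂ) (β : B.LC [⋀^Fin n]→ₗ[ℂ] ℂ) :
    prodFormC (c • α) (d • β) = (c * d) • prodFormC α β := by
  refine AlternatingMap.ext fun v => ?_
  rw [AlternatingMap.smul_apply, prodFormC_apply, prodFormC_apply, domCoprod_apply_eq_sum,
    domCoprod_apply_eq_sum, map_sum, map_sum, Finset.smul_sum]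
  refine Finset.sum_congr rfl fun σ _ => Quotient.inductionOn' σ fun σ => ?_
  rw [domCoprod_summand_mk_apply, domCoprod_summand_mk_apply, Units.smul_def, Units.smul_def,
    map_zsmul, map_zsmul, TensorProduct.lid_tmul, TensorProduct.lid_tmul]
  simp only [AlternatingMap.compLinearMap_apply, AlternatingMap.smul_apply, smul_eq_mul, zsmul_eq_mul]
  ring

/-- `compLinearMap` by an operator respecting the product decomposition distributes over `prodFormC` -/
lemma prodFormC_compLinearMap {m n : ℕ} (α : A.LC [⋀^Fin m]→ₗ[ℂ] ℂ) (β : B.LC [⋀^Fin n]→ₗ[ℂ] ℂ)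
    (u : (A.prod B).LC →ₗ[ℂ] (A.prod B).LC) (uA : A.LC →ₗ[ℂ] A.LC) (uB : B.LC →ₗ[ℂ] B.LC)
    (hA : fstC A B ∘ₗ u = uA ∘ₗ fstC A B) (hB : sndC A B ∘ₗ u = uB ∘ₗ sndC A B) :
    (prodFormC α β).compLinearMap u = prodFormC (α.compLinearMap uA) (β.compLinearMap uB) := by
  have hA' : ∀ x, fstC A B (u x) = uA (fstC A B x) := fun x => LinearMap.congr_fun hA x
  have hB' : ∀ x, sndC A B (u x) = uB (sndC A B x) := fun x => LinearMap.congr_fun hB x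
  refine AlternatingMap.ext fun v => ?_
  rw [AlternatingMap.compLinearMap_apply, prodFormC_apply, prodFormC_apply, domCoprod_apply_eq_sum,
    domCoprod_apply_eq_sum]
  congr 1
  refine Finset.sum_congr rfl fun σ _ => Quotient.inductionOn' σ fun σ => ?_
  rw [domCoprod_summand_mk_apply, domCoprod_summand_mk_apply]
  simp only [AlternatingMap.compLinearMap_apply, Function.comp_def, hA', hB']

end ProdC

/-! ### §4 Complexification of the Künneth trace -/

/-- on rational families the complexified trace is the structural form -/
lemma baseCA_trOf_tmul (X : Obj₂) (x : Fin (sdeg X.s X.leaf) → X.L) :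
    baseCA X.toObj (trOf X (sdeg X.s X.leaf)) (fun i => (1 : ℂ) ⊗ₜ[ℚ] x i) = (form X x : ℂ) := by
  rw [baseCA_tmul, trOf_apply_ιMulti rfl]
  have h : (x ∘ ⇑(finCongr (rfl : sdeg X.s X.leaf = sdeg X.s X.leaf))) = x :=
    funext fun i => congrArg x (Fin.ext rfl)
  rw [h]

/-- **the complexified Künneth trace is the complex exterior product of the complexified traces** -/
theorem baseCA_trOf_prod (X Y : Obj₂) :
    baseCA (X.prod Y).toObj (trOf (X.prod Y) (sdeg X.s X.leaf + sdeg Y.s Y.leaf))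
      = prodFormC (baseCA X.toObj (trOf X (sdeg X.s X.leaf))) (baseCA Y.toObj (trOf Y (sdeg Y.s Y.leaf))) := by
  classical
  haveI : Module.Free ℚ (X.prod Y).L := Module.Free.of_divisionRing ℚ _
  let bQ := Module.finBasis ℚ (X.prod Y).L
  refine Module.Basis.ext_alternating (Algebra.TensorProduct.basis ℂ bQ) fun v _ => ?_
  simp only [Algebra.TensorProduct.basis_apply]
  have hn : sdeg (X.prod Y).s (X.prod Y).leaf = sdeg X.s X.leaf + sdeg Y.s Y.leaf := rfl
  rw [prodFormC_apply, show ((fun i => (1 : ℂ) ⊗ₜ[ℚ] bQ (v i)) ∘ ⇑finSumFinEquiv)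
      = fun j => (1 : ℂ) ⊗ₜ[ℚ] ((fun i => bQ (v i)) ∘ ⇑finSumFinEquiv) j from rfl,
    lid_domCoprod_baseChange (fstL X.toObj Y.toObj) (sndL X.toObj Y.toObj) (form X) (form Y)
      _ _ (baseCA_trOf_tmul X) (baseCA_trOf_tmul Y), baseCA_tmul, trOf_apply_ιMulti hn]
  have h : ((fun i => bQ (v i)) ∘ ⇑(finCongr hn)) = fun i => bQ (v i) :=
    funext fun i => congrArg _ (Fin.ext rfl)
  rw [h]
  exact congrArg (fun q : ℚ => (q : ℂ))
    (prodForm_apply' (A := X.toObj) (B := Y.toObj) (form X) (form Y) (fun i => bQ (v i)))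

/-! ### §5 The product rule -/

/-- `TrType` as an identity of complex alternating forms -/
lemma compLinearMap_wtL_of_trType {X : Obj₂} (hX : TrType X) (n : ℕ) (z : ℂ) :
    (baseCA X.toObj (trOf X n)).compLinearMap (X.toObj.wtL z)
      = (z ^ X.dim) • baseCA X.toObj (trOf X n) := by
  refine AlternatingMap.ext fun w => ?_
  have h := LinearMap.congr_fun (hX n z) (ιMulti ℂ n w)
  rw [LinearMap.comp_apply, Obj.wt, map_apply_ιMulti, LinearMap.smul_apply] at h
  rw [AlternatingMap.compLinearMap_apply, AlternatingMap.smul_apply, baseCA_apply, baseCA_apply]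
  exact h

/-- the weight operator of `A × B` respects the product decomposition -/
lemma fstC_comp_wtL (A B : Obj) (z : ℂ) :
    fstC A B ∘ₗ (A.prod B).wtL z = A.wtL z ∘ₗ fstC A B :=
  (Obj.IsHodge.wtL_comp (isHodge_fstL A B) z).symm

/-- (Ported verbatim from the HodgeCMPerL package; no docstring in the source.) -/
lemma sndC_comp_wtL (A B : Obj) (z : ℂ) :
    sndC A B ∘ₗ (A.prod B).wtL z = B.wtL z ∘ₗ sndC A B :=
  (Obj.IsHodge.wtL_comp (isHodge_sndL A B) z).symm

/-- **product rule**: `TrType X → TrType Y → TrType (X × Y)` -/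
theorem trType_prod {X Y : Obj₂} (hX : TrType X) (hY : TrType Y) : TrType (X.prod Y) := by
  intro n z
  by_cases hn : sdeg (X.prod Y).s (X.prod Y).leaf = n
  swap
  · rw [trOf_of_ne hn, baseC_zero, LinearMap.zero_comp, smul_zero]
  subst hn
  have hab : sdeg (X.prod Y).s (X.prod Y).leaf = sdeg X.s X.leaf + sdeg Y.s Y.leaf := rfl
  rw [hab]
  apply exteriorPower.linearMap_ext
  refine AlternatingMap.ext fun w => ?_
  rw [LinearMap.compAlternatingMap_apply, LinearMap.compAlternatingMap_apply, LinearMap.comp_apply,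
    Obj.wt, map_apply_ιMulti, LinearMap.smul_apply]
  change ((baseCA (X.prod Y).toObj (trOf (X.prod Y) (sdeg X.s X.leaf + sdeg Y.s Y.leaf))).compLinearMap
      ((X.prod Y).toObj.wtL z)) w
    = z ^ (X.prod Y).dim • baseCA (X.prod Y).toObj
        (trOf (X.prod Y) (sdeg X.s X.leaf + sdeg Y.s Y.leaf)) w
  rw [baseCA_trOf_prod, prodFormC_compLinearMap _ _ _ (X.toObj.wtL z) (Y.toObj.wtL z)
      (fstC_comp_wtL X.toObj Y.toObj z) (sndC_comp_wtL X.toObj Y.toObj z),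
    compLinearMap_wtL_of_trType hX, compLinearMap_wtL_of_trType hY, prodFormC_smul, ← pow_add,
    dim_prod, AlternatingMap.smul_apply]

/-! ### §6 `TrType` for every good object; `M26` from the two remaining statements -/

/-- (Ported verbatim from the HodgeCMPerL package; no docstring in the source.) -/
lemma trType_leafObj : ∀ (lf : Leaf), lf.Good → TrType ⟨.unit, fun _ => lf⟩
  | .atom a, _ => trType_of_isBlockFree (fun _ => Leaf.isPB_atom a)
  | .pb _, h => trType_pbObj h

/-- (Ported verbatim from the HodgeCMPerL package; no docstring in the source.) -/
lemma trType_expand : ∀ (s : Shape) (l : s.toType → Leaf), (∀ u, (l u).Good) → TrType ⟨s, l⟩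
  | .empty, l, _ => trType_of_isBlockFree (fun u => u.elim)
  | .unit, l, h => by
      have e : (⟨.unit, l⟩ : Obj₂) = ⟨.unit, fun _ => l ()⟩ := by
        congr 1
      rw [e]
      exact trType_leafObj (l ()) (h ())
  | .sum a b, l, h => by
      have e : (⟨.sum a b, l⟩ : Obj₂)
          = Obj₂.prod ⟨a, fun u => l (Sum.inl u)⟩ ⟨b, fun u => l (Sum.inr u)⟩ := by
        simp only [Obj₂.prod, Obj₂.mk.injEq, heq_eq_eq, true_and]
        funext u
        rcases u with u | u <;> rfl
      rw [e]
      exact trType_prod (trType_expand a _ fun u => h (Sum.inl u))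
        (trType_expand b _ fun u => h (Sum.inr u))

/-- **every good object has trace of Hodge type `(dim, dim)`** -/
theorem trType_of_good {X : Obj₂} (h : X.Good) : TrType X := by
  obtain ⟨s, l⟩ := X
  exact trType_expand s l h

/-- `M26` for the good universe from the two remaining statements (G1 radical lemma, G3 Hodge–Riesz) -/
theorem gysin_of_rad_riesz (pl : GBlocks)
    (h1 : ∀ (S X : Obj₂) (f : Hom₂ S X), S.Good → X.Good → S.dim = 2 → RadKilled S X f)
    (h2 : ∀ X : Obj₂, X.Good → HodgeRiesz X) :
    (toyModel3With exteriorHodgeData traceSys pl).Fact_gysin_surface :=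
  gysin_of pl (fun _ hS _ => trType_of_good hS) h1 h2

/-- **all 28 model axioms for `toyUniverse₃ d t` from `RadKilled` and `HodgeRiesz`** -/
theorem toyUniverse₃_modelAxioms_of' (d t : ℚ)
    (h1 : ∀ (S X : Obj₂) (f : Hom₂ S X), S.Good → X.Good → S.dim = 2 → RadKilled S X f)
    (h2 : ∀ X : Obj₂, X.Good → HodgeRiesz X) :
    (toyUniverse₃ d t).ModelAxioms :=
  toyUniverse₃_modelAxioms_of d t (fun _ hS _ => trType_of_good hS) h1 h2

end

end HodgeCM.ToyG2
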